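import Summits.BirchSwinnertonDyer.Rank1Residual.P2.TransportAtTwo
import Summits.BirchSwinnertonDyer.Rank1Residual.Additive.X4ThreeResCertKernel
import Summits.BirchSwinnertonDyer.Rank1Residual.AdditivePotMult.TwistSupplyJClass
import Summits.BirchSwinnertonDyer.Rank1Residual.X5.RationalTwoTorsionPoints
import Summits.BirchSwinnertonDyer.Rank1Residual.X5.TwoAdicInstancesToolkit
import Summits.BirchSwinnertonDyer.BirchSwinnertonDyer.Theorems.Rank1ResidualIntModelReduction
import Literature.NumberTheory.EllipticCurves.Rank1Residual.X11RankOneCertificates.Minimality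
import Literature.NumberTheory.EllipticCurves.Rank1Residual.Typed.Basic
import Literature.NumberTheory.EllipticCurves.NoEverywhereGoodReductionRat
import Literature.NumberTheory.EllipticCurves.LeadingTermBSZOrdinaryProofs
import Literature.NumberTheory.EllipticCurves.Rank1Residual.GVParityTwistTransportProofs
import Literature.NumberTheory.EllipticCurves.IsogenyVariableChangeProofs
import HarnessLib

/-!
# K4 crux `AdditiveRankZeroAtTwo` (19098), children C3″ `AdditivePotGoodLowerHalfAtTwo` (22617) and C2″
# `AdditivePotGoodReducibleRestAtTwo` (22616): an INFINITE FAMILY inside the additive, potentially good,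
# `E[2]`-reducible, non-CM, analytic-rank-0 block on which BSD₂ — BOTH halves — follows from PRINT ALONE
# (Cai–Li–Zhai 2020 §6.2.2: the twists of `56b1` by `M = q₁⋯q_r`, `q_i ≡ 1 (mod 4)` inert in `ℚ(√−7)`, `ℚ(√2)`)

Cell `bsd-2adic`, seat `bsd-2adic-k4-w2` GEN 5 (prover, explicit unit, no kit); `--supports
stmt-BirchSwinnertonDyer-22617 --as helper` (serves 22616 and the parent 19098 equally). HONEST FRAMING
(D-0036/D-0054): conditional theorems on three PUBLISHED facts BY NAME — Cai–Li–Zhai 2020 §6.2.2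
(`CaiLiZhai2019.sec62_twists_34A1_56B1_99C1`, typed by the b2b-p2 literature seat; its flag «proof not printed in
detail» — "the analogous methods of quadratic twists of `X₀(14)` would apply" — is inherited verbatim), modularity
(`hasEntireLFunction_rat`), Gross–Zagier–Kolyvagin (`rank_eq_analyticRank_of_analyticRank_le_one`); NO reading,
NO instrument/record input, NO base certificate; closes nothing at the `∀`-level (C3″/C2″ stay research-open off
this family); nothing booked; BSD is not proved by any of this.

WHY. Every kernel theorem of the cell deciding a half of BSD₂ at an ADDITIVE class does so modulo an
instrument/record input (Selmer counts, `#Ш_an`, `r_an`) or a reading of Kato. Presearch of the printed «2-part of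
BSD for quadratic-twist families» literature (Zhai 2016, Cai–Li–Zhai 2020, Zhai 2021, Shu–Zhai 2021,
Adachi–Nomoto–Shii 2026 — all typed under `Literature/NumberTheory/EllipticCurves/`) finds exactly ONE printed
family in this seat's partition: Cai–Li–Zhai, J. LMS 101 (2020) §6.2.2 — `A = 56b1 : y² = x³ − x² − 4` "which has
potentially supersingular reduction at `2`", `A(ℚ) = ℤ/2`, `Δ = −2¹⁰·7`, `ℚ(A[2]) = ℚ(√−7)`, `ℚ(A′[2]) = ℚ(√2)`;
for `M = q₁⋯q_r`, `r ≥ 1`, distinct primes `q_i ≡ 1 (mod 4)` inert in both fields (printed `𝒮 = {5, 13, 61, 101,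
157, 173, 181, 229, …}`, positive density): "`ord₂(L^{(alg)}(A^{(M)},1)) = r − 1`, and the `2`-part of Birch and
Swinnerton-Dyer conjecture is valid for all these twists" (held text `paper:arxiv-1712.01271` chunk p0014
L45–L59). (The `X₀(14)`/`34a1` twists of the same § are MULTIPLICATIVE at `2` — item 19096 —, the `99c1` twists
GOOD ORDINARY — 19095. Lane A's addL2x GEN 3 R-B27 «no print twist theorem reaches the `a ≥ 4` RESIDUE classes» is a
different question: this family has `Ш[2^∞] = 0` by print — the `a = 0` part of the `∀`.)

WHAT IS PROVED (0 `def`, 0 `sorry`). For every nonempty finite set `Q` of primes `q ≡ 1 (mod 4)` inert in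
`ℚ(√−7)` and `ℚ(√2)` (`CaiLiZhai2019.IsInertIn`), `M := ∏ Q`, and EVERY globally minimal `W / ℚ` isomorphic over
`ℚ` to `56b1^{(M)}`: `printFamily56b1` — `r_an(W) = 0`, `Addv W 2`, `0 ≤ ord₂ j(W)`, `¬CM`, `Red W 2`, `BSDp W 2`,
`MissingLowerBoundAt W 2`, `MissingUpperBoundAt W 2` — the binders of C3″/C2″ at `W` DECIDED IN THE KERNEL, their
conclusions (indeed the parent's `BSD(W, 2)`) from the three facts; `printFamily56b1_model` — the same at the
explicit model `V_M : y² = x³ − M x² − 4M³` (`= C56B1.quadraticTwist M` on the nose), proved elliptic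
(`Δ = −2¹⁰·7·M⁶`), GLOBALLY MINIMAL (`M` odd square-free ⇒ `v_q Δ < 12` everywhere; `isGloballyMinimal_of_int_criterion`),
ADDITIVE at `2` (`2 ∣ Δ`, `2 ∣ c₄ = 16M²`; `Additive.addv_of_intModel`), with `j = −4/7` (`ord₂ j ≥ 0`; `ord₇ j < 0` ⇒
non-CM) and the rational `2`-torsion point `(2M, 0)`; the habitat is transported to any model `C • V_M` by the
tree's isomorphism invariances; `pPartBSD W 2 → BSDp W 2` is the b2b-p2 bridge `P2.bsdp_two_of_pPartBSD`.

WHAT THIS IS NOT. Nothing about the 1 480 residue classes (`a ≥ 4`); no item closes; the §6.2 fact is taken AS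
PRINTED (no `_holds`; the pair road through Thm 1.1/1.5 with a certified base `BSD(56b1, 2)` is the tree's
`P2.bsdp_two_twist_of_caiLiZhai`); inertness of a given prime (e.g. `5 ∈ 𝒮`) stays a hypothesis.

References: [CaiLiZhai2019] J. Lond. Math. Soc. (2) 101 (2020) 714–734 = arXiv:1712.01271, Thm. 1.1, Thm. 1.5,
§6.2.2; [SilvermanAEC2009] VII.1 Rem. 1.1, VII.5 Prop. 5.1, VIII.8, App. C §11; [Miller2011LMS] Def. 1.1.
-/

set_option autoImplicit false
set_option linter.dupNamespace false

noncomputable section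

open scoped Classical

open WeierstrassCurve Literature.NumberTheory.EllipticCurves
  Literature.NumberTheory.EllipticCurves.Rank1Residual
  Literature.NumberTheory.EllipticCurves.Rank1Residual.Typed
  Literature.NumberTheory.EllipticCurves.Rank1Residual.X11RankOneCertificates
  Literature.NumberTheory.EllipticCurves.CaiLiZhai2019
  Literature.NumberTheory.EllipticCurves.Greenberg1999
  Summit.BirchSwinnertonDyer.Rank1Residual
  Summit.BirchSwinnertonDyer.Rank1Residual.X5.O1
  Summit.BirchSwinnertonDyer.Rank1Residual.X5.Instances
  Summit.BirchSwinnertonDyer.Rank1Residual.AdditivePotMult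
  Summit.BirchSwinnertonDyer.Rank1Residual.Additive
  Summit.BirchSwinnertonDyer.Rank1Residual.P2
  Summit.BirchSwinnertonDyer.BirchSwinnertonDyer.Rank1Residual.IntModel

namespace Summit.BirchSwinnertonDyer.BirchSwinnertonDyer.Theorems.AddPotGoodPrint

/-! ## §1 The twisted models `V_M : y² = x³ − M x² − 4M³` -/

/-- The tree's quadratic twist of `56b1 = [0,−1,0,0,−4]` by `M` is, on the nose, `V_M : y² = x³ − M x² − 4 M³`
(`b₂ = −4`, `b₄ = 0`, `b₆ = −16`). [cite: SilvermanAEC2009, X.2 (remark after Prop. 2.4)] -/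
theorem twist_C56B1_eq (M : ℚ) :
    C56B1.quadraticTwist M = (⟨0, -M, 0, 0, -4 * M ^ 3⟩ : WeierstrassCurve ℚ) := by
  ext <;> simp [C56B1, quadraticTwist, WeierstrassCurve.b₂, WeierstrassCurve.b₄, WeierstrassCurve.b₆] <;> ring

/-- `Δ(V_M) = −7168·M⁶ = −2¹⁰·7·M⁶`. [cite: SilvermanAEC2009, III.1] -/
theorem Δ_twist56 (M : ℚ) : (⟨0, -M, 0, 0, -4 * M ^ 3⟩ : WeierstrassCurve ℚ).Δ = -7168 * M ^ 6 := by
  simp only [WeierstrassCurve.Δ, WeierstrassCurve.b₂, WeierstrassCurve.b₄, WeierstrassCurve.b₆, WeierstrassCurve.b₈]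
  ring

/-- `V_M` is an elliptic curve for `M ≠ 0`. [cite: SilvermanAEC2009, III.1] -/
theorem isElliptic_twist56 {M : ℚ} (hM : M ≠ 0) :
    (⟨0, -M, 0, 0, -4 * M ^ 3⟩ : WeierstrassCurve ℚ).IsElliptic :=
  ⟨isUnit_iff_ne_zero.mpr (by rw [Δ_twist56]; exact mul_ne_zero (by norm_num) (pow_ne_zero 6 hM))⟩

/-- The integer model: `Δ = −7168·M⁶` over `ℤ`. [cite: SilvermanAEC2009, III.1] -/
theorem intΔ_twist56 (M : ℤ) : (⟨0, -M, 0, 0, -4 * M ^ 3⟩ : WeierstrassCurve ℤ).Δ = -7168 * M ^ 6 := by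
  simp only [WeierstrassCurve.Δ, WeierstrassCurve.b₂, WeierstrassCurve.b₄, WeierstrassCurve.b₆,
    WeierstrassCurve.b₈]
  ring

/-- The integer model: `c₄ = 16·M²` over `ℤ`. [cite: SilvermanAEC2009, III.1] -/
theorem intc₄_twist56 (M : ℤ) : (⟨0, -M, 0, 0, -4 * M ^ 3⟩ : WeierstrassCurve ℤ).c₄ = 16 * M ^ 2 := by
  simp only [WeierstrassCurve.c₄, WeierstrassCurve.b₂, WeierstrassCurve.b₄]
  ring

/-- The certificate-schema discriminant `discOf [0, −M, 0, 0, −4M³] = −7168·M⁶`. [cite: SilvermanAEC2009, III.1] -/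
theorem discOf_twist56 (M : ℤ) : discOf [0, -M, 0, 0, -4 * M ^ 3] = -7168 * M ^ 6 := by
  simp only [discOf, invariants]
  ring

/-! ## §2 Global minimality of `V_M` for odd square-free `M` -/

/-- For `M` odd and square-free, `v_q(7168·M⁶) < 12` at every prime `q` (`7168 = 2¹⁰·7`: `= 10` at `2`,
`≤ 7` at `7`, `≤ 6` elsewhere). [folklore] -/
theorem padicValNat_7168_mul_pow_lt (M : ℕ) (hM : M ≠ 0) (hodd : ¬ 2 ∣ M)
    (hsq : ∀ q : ℕ, q.Prime → ¬ q ^ 2 ∣ M) {q : ℕ} (hq : q.Prime) :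
    padicValNat q (7168 * M ^ 6) < 12 := by
  haveI : Fact q.Prime := ⟨hq⟩
  have hvM : padicValNat q M ≤ 1 := by
    by_contra hle
    exact hsq q hq ((padicValNat_dvd_iff_le hM).mpr (by omega))
  have h7168 : (7168 : ℕ) = 2 ^ 10 * 7 := by norm_num
  rw [padicValNat.mul (by norm_num) (pow_ne_zero 6 hM), padicValNat.pow M 6, h7168,
    padicValNat.mul (by norm_num) (by norm_num)]
  by_cases h2 : q = 2
  · subst h2
    rw [padicValNat.prime_pow, padicValNat.eq_zero_of_not_dvd (by norm_num : ¬ 2 ∣ 7),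
      padicValNat.eq_zero_of_not_dvd hodd]
    norm_num
  · rw [padicValNat.eq_zero_of_not_dvd
      (fun h => h2 ((Nat.prime_dvd_prime_iff_eq hq Nat.prime_two).mp (hq.dvd_of_dvd_pow h)))]
    by_cases h7 : q = 7
    · subst h7
      rw [padicValNat_self]
      omega
    · rw [padicValNat.eq_zero_of_not_dvd (fun h => h7 ((Nat.prime_dvd_prime_iff_eq hq (by norm_num)).mp h))]
      omega

/-- For `M` odd and square-free no prime has `q¹² ∣ Δ(V_M) = −7168·M⁶`. [folklore] -/
theorem not_pow_twelve_dvd (M : ℕ) (hM : M ≠ 0) (hodd : ¬ 2 ∣ M)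
    (hsq : ∀ q : ℕ, q.Prime → ¬ q ^ 2 ∣ M) {q : ℕ} (hq : q.Prime) :
    ¬ (q : ℤ) ^ 12 ∣ -7168 * (M : ℤ) ^ 6 := by
  haveI : Fact q.Prime := ⟨hq⟩
  intro hd
  rw [neg_mul, dvd_neg] at hd
  have hd' : q ^ 12 ∣ 7168 * M ^ 6 := by exact_mod_cast hd
  have hne : 7168 * M ^ 6 ≠ 0 := mul_ne_zero (by norm_num) (pow_ne_zero 6 hM)
  have := (padicValNat_dvd_iff_le hne).mp hd'
  have hlt := padicValNat_7168_mul_pow_lt M hM hodd hsq hq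
  omega

/-- **`V_M : y² = x³ − M x² − 4M³` is a GLOBAL MINIMAL MODEL for `M` odd square-free** (integer model,
`v_q Δ < 12` at every prime; the tree's `isGloballyMinimal_of_int_criterion`). [cite: SilvermanAEC2009, VII.1 Remark 1.1 and VIII.8] -/
theorem isGloballyMinimal_twist56 (M : ℕ) (hM : M ≠ 0) (hodd : ¬ 2 ∣ M)
    (hsq : ∀ q : ℕ, q.Prime → ¬ q ^ 2 ∣ M) :
    (⟨0, -(M : ℚ), 0, 0, -4 * (M : ℚ) ^ 3⟩ : WeierstrassCurve ℚ).IsGloballyMinimal := by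
  have key := isGloballyMinimal_of_int_criterion 0 (-(M : ℤ)) 0 0 (-4 * (M : ℤ) ^ 3)
    (fun q hq h => not_pow_twelve_dvd M hM hodd hsq hq (by rw [← discOf_twist56]; exact h.1))
  have hcast : (⟨((0 : ℤ) : ℚ), ((-(M : ℤ) : ℤ) : ℚ), ((0 : ℤ) : ℚ), ((0 : ℤ) : ℚ),
      ((-4 * (M : ℤ) ^ 3 : ℤ) : ℚ)⟩ : WeierstrassCurve ℚ) = ⟨0, -(M : ℚ), 0, 0, -4 * (M : ℚ) ^ 3⟩ := by
    ext <;> push_cast <;> ring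
  rw [hcast] at key
  exact key

/-- The tree's integral model of `V_M` is the integer equation `[0, −M, 0, 0, −4M³]`. [folklore] -/
theorem integralModelInt_twist56 (M : ℕ) (hM : M ≠ 0) (hodd : ¬ 2 ∣ M)
    (hsq : ∀ q : ℕ, q.Prime → ¬ q ^ 2 ∣ M) :
    haveI := isGloballyMinimal_twist56 M hM hodd hsq
    integralModelInt (⟨0, -(M : ℚ), 0, 0, -4 * (M : ℚ) ^ 3⟩ : WeierstrassCurve ℚ) =
      ⟨0, -(M : ℤ), 0, 0, -4 * (M : ℤ) ^ 3⟩ := by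
  haveI := isGloballyMinimal_twist56 M hM hodd hsq
  exact integralModelInt_eq_of_map_eq _ (by ext <;> simp [WeierstrassCurve.map])

/-! ## §3 The base curve `56b1` and the habitat predicates of the twists -/

/-- `Δ(56b1) = −7168 = −2¹⁰·7` ("The discriminant of `A` is `−2¹⁰·7`"). [cite: CaiLiZhai2019, §6.2.2 (chunk p0014 L49)] -/
theorem Δ_C56B1 : C56B1.Δ = -7168 := by
  simp only [C56B1, WeierstrassCurve.Δ, WeierstrassCurve.b₂, WeierstrassCurve.b₄, WeierstrassCurve.b₆,
    WeierstrassCurve.b₈]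
  norm_num

/-- `56b1` is an elliptic curve. [cite: CaiLiZhai2019, §6.2.2] -/
theorem isElliptic_C56B1 : C56B1.IsElliptic :=
  ⟨isUnit_iff_ne_zero.mpr (by rw [Δ_C56B1]; norm_num)⟩

/-- `j(56b1) = 16³/(−7168) = −4/7`. [cite: SilvermanAEC2009, III.1] -/
theorem j_C56B1 : haveI := isElliptic_C56B1; C56B1.j = -4 / 7 := by
  haveI := isElliptic_C56B1
  have hc : C56B1.c₄ = 16 := by
    simp only [C56B1, WeierstrassCurve.c₄, WeierstrassCurve.b₂, WeierstrassCurve.b₄]; norm_num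
  rw [WeierstrassCurve.j, Units.val_inv_eq_inv_val, WeierstrassCurve.coe_Δ', Δ_C56B1, hc]
  norm_num

/-- `ord₇(−4/7) = −1`. [folklore] -/
theorem padicValRat_seven_j : padicValRat 7 (-4 / 7 : ℚ) = -1 := by
  have h4 : padicValRat 7 (4 : ℚ) = 0 := by
    rw [show (4 : ℚ) = ((4 : ℕ) : ℚ) by norm_num, padicValRat.of_nat,
      padicValNat.eq_zero_of_not_dvd (by norm_num : ¬ 7 ∣ 4)]
    norm_num
  have h7 : padicValRat 7 (7 : ℚ) = 1 := by exact_mod_cast padicValRat.self (p := 7) (by norm_num)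
  rw [padicValRat.div (by norm_num) (by norm_num), padicValRat.neg, h4, h7]
  norm_num

/-- `ord₂(−4/7) = 2`. [folklore] -/
theorem padicValRat_two_j : padicValRat 2 (-4 / 7 : ℚ) = 2 := by
  haveI : Fact (Nat.Prime 2) := ⟨Nat.prime_two⟩
  have h4 : padicValRat 2 (4 : ℚ) = 2 := by
    rw [show (4 : ℚ) = ((2 ^ 2 : ℕ) : ℚ) by norm_num, padicValRat.of_nat, padicValNat.prime_pow]
    norm_num
  have h7 : padicValRat 2 (7 : ℚ) = 0 := by
    rw [show (7 : ℚ) = ((7 : ℕ) : ℚ) by norm_num, padicValRat.of_nat,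
      padicValNat.eq_zero_of_not_dvd (by norm_num : ¬ 2 ∣ 7)]
    norm_num
  rw [padicValRat.div (by norm_num) (by norm_num), padicValRat.neg, h4, h7]
  norm_num

/-- Every model `C • 56b1^{(M)}` (`M ≠ 0`) has `j = −4/7` (`variableChange_j`, `j_quadraticTwist`).
[cite: SilvermanAEC2009, III.1 Prop. 1.4(b) and X.5 Cor. 5.4(iii)] -/
theorem j_smul_twist_C56B1 {M : ℚ} (hM : M ≠ 0) (C : VariableChange ℚ)
    [hE : (C • C56B1.quadraticTwist M).IsElliptic] : (C • C56B1.quadraticTwist M).j = -4 / 7 := by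
  haveI := isElliptic_C56B1
  haveI : (C56B1.quadraticTwist M).IsElliptic := isElliptic_quadraticTwist C56B1 hM
  rw [variableChange_j, j_quadraticTwist C56B1 hM, j_C56B1]

/-- **`V_M` is ADDITIVE at `2`** for `M` odd square-free: `2 ∣ Δ = −2¹⁰·7·M⁶`, `2 ∣ c₄ = 16M²` on the global
minimal model (the tree's `Additive.addv_of_intModel`). [cite: SilvermanAEC2009, VII.5 Prop. 5.1(c)] -/
theorem addv_two_twist56 (M : ℕ) (hM : M ≠ 0) (hodd : ¬ 2 ∣ M)
    (hsq : ∀ q : ℕ, q.Prime → ¬ q ^ 2 ∣ M) :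
    Addv (⟨0, -(M : ℚ), 0, 0, -4 * (M : ℚ) ^ 3⟩ : WeierstrassCurve ℚ) 2 := by
  haveI := isElliptic_twist56 (M := (M : ℚ)) (by exact_mod_cast hM)
  haveI := isGloballyMinimal_twist56 M hM hodd hsq
  have hI := integralModelInt_twist56 M hM hodd hsq
  refine Additive.addv_of_intModel hI 2 ?_ ?_
  · rw [intΔ_twist56]; exact ⟨-3584 * (M : ℤ) ^ 6, by ring⟩
  · rw [intc₄_twist56]; exact ⟨8 * (M : ℤ) ^ 2, by ring⟩

/-- **`V_M[2]` is REDUCIBLE**: `(2M, 0)` is a rational point of order `2`, so `ρ̄_{V_M,2}` has a rational line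
(`Red V_M 2`). [cite: SilvermanAEC2009, III.2.3] -/
theorem red_two_twist56 {M : ℚ} (hM : M ≠ 0) :
    haveI := isElliptic_twist56 hM
    Red (⟨0, -M, 0, 0, -4 * M ^ 3⟩ : WeierstrassCurve ℚ) 2 := by
  haveI := isElliptic_twist56 hM
  have hT : HasRationalTwoTorsionX (⟨0, -M, 0, 0, -4 * M ^ 3⟩ : WeierstrassCurve ℚ) (2 * M) :=
    ⟨0, by rw [WeierstrassCurve.Affine.equation_iff]; ring, by simp⟩
  obtain ⟨T, hT2⟩ := exists_point_addOrderOf_eq_two hT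
  exact red_two_of_addOrderOf_eq_two _ hT2

/-! ## §4 Admissible twisting sets: `M = ∏ Q` is odd and square-free -/

/-- A product of primes is nonzero. [folklore] -/
theorem prod_ne_zero_of_primes {Q : Finset ℕ} (hS : ∀ q ∈ Q, q.Prime) : (∏ q ∈ Q, q) ≠ 0 :=
  Finset.prod_ne_zero_iff.mpr fun q hq => (hS q hq).ne_zero
/-- A product of primes `≡ 1 (mod 4)` is odd. [folklore] -/
theorem not_two_dvd_prod_of_mod_four {Q : Finset ℕ} (hS : ∀ q ∈ Q, q.Prime ∧ q % 4 = 1) :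
    ¬ 2 ∣ ∏ q ∈ Q, q := by
  intro h
  obtain ⟨q, hq, h2⟩ := (Prime.dvd_finsetProd_iff Nat.prime_two.prime _).mp h
  have h4 := (hS q hq).2
  omega

/-- A prime dividing `∏ Q` (a finite set of primes) belongs to `Q`. [folklore] -/
theorem mem_of_prime_dvd_prod {Q : Finset ℕ} (hS : ∀ q ∈ Q, q.Prime) {p : ℕ} (hp : p.Prime)
    (h : p ∣ ∏ q ∈ Q, q) : p ∈ Q := by
  obtain ⟨q, hq, hpq⟩ := (Prime.dvd_finsetProd_iff hp.prime _).mp h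
  rwa [(Nat.prime_dvd_prime_iff_eq hp (hS q hq)).mp hpq]

/-- The product of a finite SET of primes is square-free: no prime square divides it. [folklore] -/
theorem not_sq_dvd_prod_of_primes {Q : Finset ℕ} (hS : ∀ q ∈ Q, q.Prime) (p : ℕ) (hp : p.Prime) :
    ¬ p ^ 2 ∣ ∏ q ∈ Q, q := by
  intro h
  have h1 : p ∈ Q := mem_of_prime_dvd_prod hS hp (dvd_trans (dvd_pow_self p two_ne_zero) h)
  rw [← Finset.mul_prod_erase Q (fun q => q) h1, pow_two, Nat.mul_dvd_mul_iff_left hp.pos] at h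
  have h2 := mem_of_prime_dvd_prod (fun q hq => hS q (Finset.mem_of_mem_erase hq)) hp h
  exact Finset.notMem_erase p Q h2

/-! ## §5 PRINT ⇒ BSD₂ (both halves) on the whole family, inside the additive pot-good reducible block -/

/-- **The habitat of C3″/C2″ at every model `C • 56b1^{(M)}`**, `M` odd square-free: ADDITIVE at `2`, POTENTIALLY
GOOD (`j = −4/7`, `ord₂ j ≥ 0`), NON-CM (`ord₇ j < 0`; CM `j`'s are integers), `E[2]` REDUCIBLE — decided on the
global minimal model `V_M` and transported (reduction types, `j`, reducibility are isomorphism/isogeny invariants: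
`hasGoodReductionAtPrime_iff_of_variableChange`, `hasMultiplicativeReductionAtPrime_smul_iff`, `variableChange_j`,
`isIsogenous_smul` + `not_hasIrreducibleModPGaloisRep_of_isIsogenous`). [cite: SilvermanAEC2009, VII.5 Prop. 5.1, III.1 Prop. 1.4(b), App. C §11] -/
theorem habitat_smul_twist56 (M : ℕ) (hM0 : M ≠ 0) (hodd : ¬ 2 ∣ M)
    (hsq : ∀ q : ℕ, q.Prime → ¬ q ^ 2 ∣ M) (C : VariableChange ℚ)
    [hE : (C • C56B1.quadraticTwist (M : ℚ)).IsElliptic] :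
    Addv (C • C56B1.quadraticTwist (M : ℚ)) 2 ∧ 0 ≤ padicValRat 2 (C • C56B1.quadraticTwist (M : ℚ)).j ∧
      ¬ (C • C56B1.quadraticTwist (M : ℚ)).HasCM ∧ Red (C • C56B1.quadraticTwist (M : ℚ)) 2 := by
  haveI : Fact (Nat.Prime 2) := ⟨Nat.prime_two⟩
  have hMQ : (M : ℚ) ≠ 0 := by exact_mod_cast hM0
  haveI := isElliptic_C56B1
  haveI hX : (C56B1.quadraticTwist (M : ℚ)).IsElliptic := isElliptic_quadraticTwist C56B1 hMQ
  have hj : (C • C56B1.quadraticTwist (M : ℚ)).j = -4 / 7 := j_smul_twist_C56B1 hMQ C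
  have hV : C56B1.quadraticTwist (M : ℚ) = ⟨0, -(M : ℚ), 0, 0, -4 * (M : ℚ) ^ 3⟩ := twist_C56B1_eq (M : ℚ)
  have haddV : Addv (C56B1.quadraticTwist (M : ℚ)) 2 := by
    rw [hV]; exact addv_two_twist56 M hM0 hodd hsq
  have hredV : Red (C56B1.quadraticTwist (M : ℚ)) 2 := by
    have h := red_two_twist56 hMQ
    rw [← hV] at h
    exact h
  refine ⟨⟨fun h => haddV.1 ((hasGoodReductionAtPrime_iff_of_variableChange _ C 2).mp h),
    fun h => haddV.2 ((Literature.NumberTheory.EllipticCurves.hasMultiplicativeReductionAtPrime_smul_iff _ C 2).mp h)⟩,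
    ?_, ?_, not_hasIrreducibleModPGaloisRep_of_isIsogenous (isIsogenous_smul _ C) hredV⟩
  · rw [hj, padicValRat_two_j]; norm_num
  · exact not_hasCM_of_padicValRat_j_neg (p := 7) (by rw [hj, padicValRat_seven_j]; norm_num)

/-- **PRINT ⇒ `BSD(W, 2)` — both halves — on the whole Cai–Li–Zhai `56b1`-family, inside the additive,
potentially good, `E[2]`-reducible, non-CM, analytic-rank-0 block of K4's crux `AdditiveRankZeroAtTwo`.**
For every nonempty finite set `Q` of primes `q ≡ 1 (mod 4)` inert in `ℚ(√−7)` and `ℚ(√2)`, `M = ∏ Q`, and every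
GLOBALLY MINIMAL `W / ℚ` isomorphic to `56b1^{(M)}`: the binders of C3″ (22617) / C2″ (22616) hold at `W`
(`r_an = 0` from the printed `L(A^{(M)},1) ≠ 0` under modularity, `Addv W 2`, `0 ≤ ord₂ j`, `¬CM`, `Red W 2`) and
so do their conclusions `MissingLowerBoundAt W 2` / `MissingUpperBoundAt W 2`, through the parent's `BSDp W 2`:
the printed "the `2`-part of BSD is valid for all these twists" (`pPartBSD W 2`, fact
`sec62_twists_34A1_56B1_99C1`) converted by `P2.bsdp_two_of_pPartBSD` (GZK, modularity). Three PUBLISHED facts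
by name; no reading / instrument / record. Infinite family (printed `𝒮 = {5, 13, 61, 101, 157, …}`, positive
density), conductors `56·M²`; inertness of the chosen primes is the caller's hypothesis.
[cite: CaiLiZhai2019, §6.2.2 (arXiv:1712.01271 chunk p0014 L45–L59), Thm. 1.1, Thm. 1.5] [cite: Miller2011LMS, Def. 1.1] -/
theorem printFamily56b1 (h62 : sec62_twists_34A1_56B1_99C1) (hmod : hasEntireLFunction_rat)
    (hGZK : rank_eq_analyticRank_of_analyticRank_le_one)
    (Q : Finset ℕ) (hQ : Q.Nonempty)
    (hS : ∀ q ∈ Q, q.Prime ∧ q % 4 = 1 ∧ IsInertIn q (-7) ∧ IsInertIn q 2)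
    (W : WeierstrassCurve ℚ) [W.IsElliptic] [W.IsGloballyMinimal]
    (hW : ∃ C : VariableChange ℚ, C • C56B1.quadraticTwist ((∏ q ∈ Q, q : ℕ) : ℚ) = W) :
    W.analyticRank = 0 ∧ Addv W 2 ∧ 0 ≤ padicValRat 2 W.j ∧ ¬ W.HasCM ∧ Red W 2 ∧
      BSDp W 2 ∧ MissingLowerBoundAt W 2 ∧ MissingUpperBoundAt W 2 := by
  haveI : Fact (Nat.Prime 2) := ⟨Nat.prime_two⟩
  -- the printed conclusions (Cai–Li–Zhai 2020 §6.2.2) in Miller's currency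
  obtain ⟨hL, -, hPB⟩ := h62.2.1 Q hQ hS W hW
  have hr : W.analyticRank = 0 := (W.analyticRank_eq_zero_iff_holds (hmod W)).mpr hL
  have hr1 : W.analyticRank ≤ 1 := by rw [hr]; exact zero_le_one
  have hB : BSDp W 2 := bsdp_two_of_pPartBSD hmod hGZK W hr1 hPB
  haveI : Finite W.sha := (hGZK W hr1).2
  have hLU := lower_and_upper_of_missingPPartAt W 2 (missingPPartAt_of_bsdp W 2 hB)
  -- the habitat: decided on the explicit globally minimal model, transported along `C`
  have hS1 : ∀ q ∈ Q, q.Prime := fun q hq => (hS q hq).1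
  obtain ⟨C, rfl⟩ := hW
  have hab := habitat_smul_twist56 (∏ q ∈ Q, q) (prod_ne_zero_of_primes hS1)
    (not_two_dvd_prod_of_mod_four fun q hq => ⟨(hS q hq).1, (hS q hq).2.1⟩)
    (not_sq_dvd_prod_of_primes hS1) C
  exact ⟨hr, hab.1, hab.2.1, hab.2.2.1, hab.2.2.2, hB, hLU⟩

/-! ## §6 The explicit global minimal models `V_M`, `M = ∏ Q` -/

/-- For an admissible `Q` (primes `≡ 1 (mod 4)`), `V_{∏Q}` is an elliptic curve. [cite: SilvermanAEC2009, III.1] -/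
theorem isElliptic_twist56_prod {Q : Finset ℕ} (hS : ∀ q ∈ Q, q.Prime) :
    (⟨0, -((∏ q ∈ Q, q : ℕ) : ℚ), 0, 0, -4 * ((∏ q ∈ Q, q : ℕ) : ℚ) ^ 3⟩ : WeierstrassCurve ℚ).IsElliptic :=
  isElliptic_twist56 (by exact_mod_cast prod_ne_zero_of_primes hS)

/-- For an admissible `Q` (primes `≡ 1 (mod 4)`), `V_{∏Q}` is a GLOBAL MINIMAL MODEL. [cite: SilvermanAEC2009, VII.1 Remark 1.1 and VIII.8] -/
theorem isGloballyMinimal_twist56_prod {Q : Finset ℕ} (hS : ∀ q ∈ Q, q.Prime ∧ q % 4 = 1) :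
    (⟨0, -((∏ q ∈ Q, q : ℕ) : ℚ), 0, 0, -4 * ((∏ q ∈ Q, q : ℕ) : ℚ) ^ 3⟩ : WeierstrassCurve ℚ).IsGloballyMinimal :=
  isGloballyMinimal_twist56 _ (prod_ne_zero_of_primes fun q hq => (hS q hq).1)
    (not_two_dvd_prod_of_mod_four hS) (not_sq_dvd_prod_of_primes fun q hq => (hS q hq).1)

/-- **PRINT ⇒ `BSD(V_M, 2)` on the explicit global minimal models** `V_M : y² = x³ − M x² − 4M³`, `M = ∏ Q`
(`Q` as in `printFamily56b1`; ellipticity / global minimality instances: any, e.g. the kernel's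
`isElliptic_twist56_prod` / `isGloballyMinimal_twist56_prod`): `V_M` is a non-CM curve of analytic rank `0`,
additive and potentially good at `2` with `E[2]` reducible — a point of the habitat of C3″ (22617) and of C2″
(22616) — at which `BSD(V_M, 2)`, `MissingLowerBoundAt V_M 2` and `MissingUpperBoundAt V_M 2` hold, from the three
named facts alone. [cite: CaiLiZhai2019, §6.2.2 (arXiv:1712.01271 chunk p0014 L45–L59)] [cite: Miller2011LMS, Def. 1.1] -/
theorem printFamily56b1_model (h62 : sec62_twists_34A1_56B1_99C1) (hmod : hasEntireLFunction_rat)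
    (hGZK : rank_eq_analyticRank_of_analyticRank_le_one)
    (Q : Finset ℕ) (hQ : Q.Nonempty)
    (hS : ∀ q ∈ Q, q.Prime ∧ q % 4 = 1 ∧ IsInertIn q (-7) ∧ IsInertIn q 2)
    (V : WeierstrassCurve ℚ) [V.IsElliptic] [V.IsGloballyMinimal]
    (hV : V = ⟨0, -((∏ q ∈ Q, q : ℕ) : ℚ), 0, 0, -4 * ((∏ q ∈ Q, q : ℕ) : ℚ) ^ 3⟩) :
    V.analyticRank = 0 ∧ Addv V 2 ∧ 0 ≤ padicValRat 2 V.j ∧ ¬ V.HasCM ∧ Red V 2 ∧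
      BSDp V 2 ∧ MissingLowerBoundAt V 2 ∧ MissingUpperBoundAt V 2 := by
  subst hV
  exact printFamily56b1 h62 hmod hGZK Q hQ hS _ ⟨1, by rw [one_smul, twist_C56B1_eq]⟩

/-- **One member spelled out: `M = 5`** (the first printed element of `𝒮`; conductor `56·25 = 1400`):
granted that `5` is inert in `ℚ(√−7)` and in `ℚ(√2)` (printed; a hypothesis here, as in the Literature file),
`BSD(V₅, 2)` with both halves holds for `V₅ : y² = x³ − 5x² − 500` from the three named facts.
[cite: CaiLiZhai2019, §6.2.2 (the list 𝒮, chunk p0014 L51–L53)] -/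
theorem printFamily56b1_five (h62 : sec62_twists_34A1_56B1_99C1) (hmod : hasEntireLFunction_rat)
    (hGZK : rank_eq_analyticRank_of_analyticRank_le_one) (hin7 : IsInertIn 5 (-7)) (hin2 : IsInertIn 5 2)
    (W : WeierstrassCurve ℚ) [W.IsElliptic] [W.IsGloballyMinimal]
    (hW : ∃ C : VariableChange ℚ, C • C56B1.quadraticTwist (5 : ℚ) = W) :
    W.analyticRank = 0 ∧ Addv W 2 ∧ 0 ≤ padicValRat 2 W.j ∧ ¬ W.HasCM ∧ Red W 2 ∧
      BSDp W 2 ∧ MissingLowerBoundAt W 2 ∧ MissingUpperBoundAt W 2 := by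
  have h := printFamily56b1 h62 hmod hGZK {5} (Finset.singleton_nonempty 5)
    (fun q hq => by
      rw [Finset.mem_singleton] at hq
      subst hq
      exact ⟨by norm_num, by norm_num, hin7, hin2⟩) W
  rw [Finset.prod_singleton] at h
  exact h (by exact_mod_cast hW)

end Summit.BirchSwinnertonDyer.BirchSwinnertonDyer.Theorems.AddPotGoodPrint

end
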